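import Literature.Geometry.GeometricMeasureTheory.AreaFormula
import Literature.Geometry.Lorentzian.RiemannianMeasureDensity
import Literature.Geometry.Riemannian.RoundSphere
import Mathlib.Geometry.Manifold.MFDeriv.Atlas
import HarnessLib

/-!
# The area measure of an embedded submanifold of a Euclidean space is Hausdorff measure

Topic `Literature/Geometry/Riemannian`. For an injective Riemannian immersion `f : N → V` of a
compact `m`-manifold (modelled on `ℝᵐ`) into a Euclidean space `V` — an embedding — the Riemannian
measure `μ_{f^*δ}` of the induced metric (`riemannianMeasure`, `Volume.lean`;
`inducedRiemannianMetric`, `Hypersurface.lean`) is the `m`-dimensional (Euclidean-normalised)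
Hausdorff measure of the image:

* `riemannianMeasure_induced_apply_of_subset_source` (chart-local), `riemannianMeasure_induced_apply`
  — `μ_{f^*δ}(S) = 𝓗ᵐ(f(S))` for measurable `S`;
* `map_riemannianMeasure_induced` — `f_* μ_{f^*δ} = 𝓗ᵐ ⌊ f(N)`;
* `lintegral_comp_riemannianMeasure_induced`, `integral_comp_riemannianMeasure_induced` —
  `∫_N g ∘ f dμ_{f^*δ} = ∫_{f(N)} g d𝓗ᵐ`.

Proof: in a chart, `μ_{f^*δ}(S) = ∫_{φ S} √det (f^*δ)ᵢⱼ` (`riemannianMeasure_eq_integral_sqrt_det_holds`,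
`VolumeChartFormula.lean`) and `𝓗ᵐ((f ∘ φ⁻¹)(φ S)) = ∫_{φ S} √det (⟪D(f∘φ⁻¹) eᵢ, D(f∘φ⁻¹) eⱼ⟫)`
(the tree's area formula for injective `C¹` immersions,
`Geometry/GeometricMeasureTheory/AreaFormula.lean`), with identical Gram integrands
(`hasFDerivAt_comp_extChartAt_symm`); a finite chart cover and the measurability of images under the
closed embedding `f` conclude. This links the intrinsic area functionals of the tree's mean
curvature flow files (`MCFAreaEvolution.lean`, `HuiskenMonotonicity.lean`) with the extrinsic
Gaussian areas / entropy of `ColdingMinicozziEntropy.lean`. Everything is PROVED; no definitions,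
no named facts.

## References

* H. Federer, *Geometric Measure Theory*, Springer 1969, 3.2.3 (area formula) and 3.2.46
  (Riemannian measure = Hausdorff measure). [Federer1969]
* L. C. Evans, R. F. Gariepy, *Measure Theory and Fine Properties of Functions*, CRC 1992, §3.3.
-/

noncomputable section

open Manifold Bundle MeasureTheory MeasureTheory.Measure Set Filter Function Module
open scoped ContDiff Topology ENNReal RealInnerProductSpace

namespace Literature.Geometry.Riemannian

open Lorentzian Lorentzian.PseudoRiemannianMetric Literature.Geometry.GeometricMeasureTheory

section InducedHausdorff

variable {m : ℕ} {N : Type*} [TopologicalSpace N] [ChartedSpace (EuclideanSpace ℝ (Fin m)) N]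
  [IsManifold (𝓡 m) ∞ N]
  {V : Type*} [NormedAddCommGroup V] [InnerProductSpace ℝ V]
  [MeasurableSpace V] [BorelSpace V]

omit [MeasurableSpace V] [BorelSpace V] in
/-- The chart representative `f ∘ φ⁻¹` of an immersion and its differential on the chart target:
`D(f ∘ φ⁻¹)(y) = df_{φ⁻¹ y} ∘ D(φ⁻¹)(y)`. [folklore] -/
theorem hasFDerivAt_comp_extChartAt_symm {f : N → V} (hf : ContMDiff (𝓡 m) 𝓘(ℝ, V) ∞ f) (x : N)
    {y : EuclideanSpace ℝ (Fin m)} (hy : y ∈ (extChartAt (𝓡 m) x).target) :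
    HasFDerivAt (f ∘ (extChartAt (𝓡 m) x).symm)
      ((mfderiv (𝓡 m) 𝓘(ℝ, V) f ((extChartAt (𝓡 m) x).symm y)).comp
        (mfderivWithin 𝓘(ℝ, EuclideanSpace ℝ (Fin m)) (𝓡 m) (extChartAt (𝓡 m) x).symm
          (range (𝓡 m)) y)) y := by
  have hφ : MDifferentiableWithinAt 𝓘(ℝ, EuclideanSpace ℝ (Fin m)) (𝓡 m) (extChartAt (𝓡 m) x).symm
      (range (𝓡 m)) y :=
    (((contMDiffOn_extChartAt_symm (n := ∞) x).mdifferentiableOn (by simp) y hy).mdifferentiableAt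
      ((isOpen_extChartAt_target x).mem_nhds hy)).mdifferentiableWithinAt
  have hφ' : HasMFDerivWithinAt 𝓘(ℝ, EuclideanSpace ℝ (Fin m)) (𝓡 m) (extChartAt (𝓡 m) x).symm
      (range (𝓡 m)) y (mfderivWithin 𝓘(ℝ, EuclideanSpace ℝ (Fin m)) (𝓡 m) (extChartAt (𝓡 m) x).symm
        (range (𝓡 m)) y) := hφ.hasMFDerivWithinAt
  have hfd : HasMFDerivAt (𝓡 m) 𝓘(ℝ, V) f ((extChartAt (𝓡 m) x).symm y)
      (mfderiv (𝓡 m) 𝓘(ℝ, V) f ((extChartAt (𝓡 m) x).symm y)) :=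
    ((hf _).mdifferentiableAt (by simp)).hasMFDerivAt
  have hcomp := hfd.comp_hasMFDerivWithinAt y hφ'
  rw [ModelWithCorners.Boundaryless.range_eq_univ] at hcomp ⊢
  rw [hasMFDerivWithinAt_univ] at hcomp
  exact hcomp.hasFDerivAt

-- (The injectivity of the differential of a spacelike immersion, used below, is
-- `IsSpacelikeImmersion.injective_mfderiv` of `Geometry/Lorentzian/Hypersurface.lean`; the former
-- local restatement `injective_mfderiv_of_isSpacelikeImmersion` was removed as a duplicate, dedup-01300.)

variable [T3Space N] [MeasurableSpace N] [BorelSpace N]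

/-- **Chart-local area formula for an embedded submanifold**: for an injective Riemannian
immersion `f : N → V` of an `m`-manifold into a Euclidean space and a measurable `S` inside a
chart domain, the induced Riemannian measure of `S` is the `m`-dimensional Hausdorff measure of
`f(S)`: `μ_{f^*δ}(S) = 𝓗ᵐ(f S)` — the chart formula `μ_{f^*δ}(S) = ∫_{φ S} √det (f^*δ)ᵢⱼ`
(`riemannianMeasure_eq_integral_sqrt_det_holds`) and the area formula for the injective immersion
`f ∘ φ⁻¹` (`euclideanHausdorffMeasure_image_eq_lintegral_sqrt_det_gram`), whose Gram integrands
coincide. [cite: Federer1969, 3.2.3 and 3.2.46] -/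
theorem riemannianMeasure_induced_apply_of_subset_source {f : N → V}
    (hf : (euclideanMetric V).IsSpacelikeImmersion (𝓡 m) f) (hinj : Injective f) (x : N)
    {S : Set N} (hS : MeasurableSet S) (hSx : S ⊆ (extChartAt (𝓡 m) x).source) :
    riemannianMeasure ((euclideanMetric V).inducedRiemannianMetric f contMDiff_pullbackBilin_holds hf) S =
      μHE[m] (f '' S) := by
  set φ := extChartAt (𝓡 m) x with hφ
  set F₂ : EuclideanSpace ℝ (Fin m) → V := f ∘ φ.symm with hF₂
  set F₂' : EuclideanSpace ℝ (Fin m) → EuclideanSpace ℝ (Fin m) →L[ℝ] V := fun y ↦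
    (mfderiv (𝓡 m) 𝓘(ℝ, V) f (φ.symm y)).comp
      (mfderivWithin 𝓘(ℝ, EuclideanSpace ℝ (Fin m)) (𝓡 m) φ.symm (range (𝓡 m)) y) with hF₂'
  have hU : IsOpen φ.target := isOpen_extChartAt_target x
  have hFd : ∀ y ∈ φ.target, HasFDerivAt F₂ (F₂' y) y := fun y hy ↦
    hasFDerivAt_comp_extChartAt_symm hf.contMDiff x hy
  -- `F₂` is smooth on the target, so `F₂' = DF₂` is continuous there
  have hF₂s : ContDiffOn ℝ ∞ F₂ φ.target :=
    (hf.contMDiff.comp_contMDiffOn (contMDiffOn_extChartAt_symm (n := ∞) x)).contDiffOn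
  have hF'c : ContinuousOn F₂' φ.target := by
    refine (hF₂s.continuousOn_fderiv_of_isOpen hU (by simp)).congr fun y hy ↦ ?_
    exact (hFd y hy).fderiv.symm
  have hinjOn : InjOn F₂ φ.target := by
    refine hinj.injOn.comp ?_ (mapsTo_univ _ _)
    simpa using φ.symm.injOn
  have himm : ∀ y ∈ φ.target, Injective (F₂' y) := fun y hy ↦
    (hf.injective_mfderiv _).comp
      (isInvertible_mfderivWithin_extChartAt_symm hy).injective
  -- the chart formula for the induced measure
  rw [riemannianMeasure_eq_integral_sqrt_det_holds _ x hS hSx]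
  -- the area formula for `F₂` on `φ '' S`
  have hS' : MeasurableSet (φ '' S) := measurableSet_image_extChartAt x hS hSx
  have hS'U : φ '' S ⊆ φ.target := fun y ⟨z, hz, hzy⟩ ↦ hzy ▸ φ.map_source (hSx hz)
  have harea := euclideanHausdorffMeasure_image_eq_lintegral_sqrt_det_gram
    (EuclideanSpace.basisFun (Fin m) ℝ) hU hFd hF'c hinjOn himm hS' hS'U
  rw [finrank_euclideanSpace_fin] at harea
  have himage : F₂ '' (φ '' S) = f '' S := by
    rw [image_image]
    refine image_congr fun z hz ↦ ?_
    show f (φ.symm (φ z)) = f z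
    rw [φ.left_inv (hSx hz)]
  rw [himage] at harea
  rw [harea]
  refine setLIntegral_congr_fun hS' fun y hy ↦ ?_
  congr 3
  ext i j
  simp only [chartGramMatrix, Matrix.of_apply, inducedRiemannianMetric_inner, hF₂',
    EuclideanSpace.basisFun_apply]
  rw [inducedBilin_apply, euclideanMetric_apply]
  rfl


variable [CompactSpace N]

/-- **The induced Riemannian measure of an embedded submanifold is Hausdorff measure**: for an
injective Riemannian immersion `f : N → V` of a compact `m`-manifold into a Euclidean space,
`μ_{f^*δ}(S) = 𝓗ᵐ(f(S))` for every measurable `S ⊆ N` (finite chart cover of the chart-local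
statement; `f` is a closed embedding, so images of measurable sets are measurable).
[cite: Federer1969, 3.2.3 and 3.2.46] -/
theorem riemannianMeasure_induced_apply {f : N → V}
    (hf : (euclideanMetric V).IsSpacelikeImmersion (𝓡 m) f) (hinj : Injective f)
    {S : Set N} (hS : MeasurableSet S) :
    riemannianMeasure ((euclideanMetric V).inducedRiemannianMetric f contMDiff_pullbackBilin_holds hf) S =
      μHE[m] (f '' S) := by
  classical
  have hme : MeasurableEmbedding f :=
    (hf.contMDiff.continuous.isClosedEmbedding hinj).measurableEmbedding
  obtain ⟨T, hT⟩ := isCompact_univ.elim_finite_subcover (fun x : N ↦ (extChartAt (𝓡 m) x).source)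
    (fun x ↦ isOpen_extChartAt_source x) (fun x _ ↦ mem_iUnion.2 ⟨x, mem_extChartAt_source x⟩)
  suffices key : ∀ (T : Finset N) (A : Set N), MeasurableSet A →
      A ⊆ (⋃ x ∈ T, (extChartAt (𝓡 m) x).source) →
        riemannianMeasure ((euclideanMetric V).inducedRiemannianMetric f contMDiff_pullbackBilin_holds hf) A =
          μHE[m] (f '' A) from
    key T S hS fun z hz ↦ hT (mem_univ z)
  intro T
  induction T using Finset.induction_on with
  | empty =>
    intro A _ hAT
    have hA0 : A = ∅ := subset_empty_iff.1 (by simpa using hAT)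
    subst hA0
    simp
  | insert x T hxT ih =>
    intro A hAm hAT
    have hsrc : MeasurableSet (extChartAt (𝓡 m) x).source := (isOpen_extChartAt_source x).measurableSet
    have hsplit : A = (A ∩ (extChartAt (𝓡 m) x).source) ∪ (A \ (extChartAt (𝓡 m) x).source) :=
      (inter_union_sdiff _ _).symm
    have hdisj : Disjoint (A ∩ (extChartAt (𝓡 m) x).source) (A \ (extChartAt (𝓡 m) x).source) :=
      disjoint_left.2 fun z hz hz' ↦ hz'.2 hz.2
    have hrest : A \ (extChartAt (𝓡 m) x).source ⊆ ⋃ y ∈ T, (extChartAt (𝓡 m) y).source := by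
      intro z hz
      have hz' := hAT hz.1
      rw [Finset.set_biUnion_insert, mem_union] at hz'
      exact hz'.resolve_left hz.2
    rw [hsplit, measure_union hdisj (hAm.diff hsrc), image_union,
      measure_union ((Set.disjoint_image_iff hinj).2 hdisj) (hme.measurableSet_image.2 (hAm.diff hsrc)),
      riemannianMeasure_induced_apply_of_subset_source hf hinj x (hAm.inter hsrc) inter_subset_right,
      ih _ (hAm.diff hsrc) hrest]

/-- **Push-forward form**: `f_* μ_{f^*δ} = 𝓗ᵐ ⌊ f(N)`. [cite: Federer1969, 3.2.3 and 3.2.46] -/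
theorem map_riemannianMeasure_induced {f : N → V}
    (hf : (euclideanMetric V).IsSpacelikeImmersion (𝓡 m) f) (hinj : Injective f) :
    Measure.map f (riemannianMeasure ((euclideanMetric V).inducedRiemannianMetric f
      contMDiff_pullbackBilin_holds hf)) = (μHE[m]).restrict (range f) := by
  have hme : MeasurableEmbedding f :=
    (hf.contMDiff.continuous.isClosedEmbedding hinj).measurableEmbedding
  refine Measure.ext fun B hB ↦ ?_
  rw [Measure.map_apply hme.measurable hB, Measure.restrict_apply hB,
    riemannianMeasure_induced_apply hf hinj (hme.measurable hB), image_preimage_eq_inter_range]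

/-- **Integration over the embedded submanifold** (`ℝ≥0∞`-valued): `∫⁻_N g(f w) dμ_{f^*δ} =
∫⁻_{f(N)} g d𝓗ᵐ` for every `g`. [cite: Federer1969, 3.2.3 and 3.2.46] -/
theorem lintegral_comp_riemannianMeasure_induced {f : N → V}
    (hf : (euclideanMetric V).IsSpacelikeImmersion (𝓡 m) f) (hinj : Injective f) (g : V → ℝ≥0∞) :
    ∫⁻ w, g (f w) ∂riemannianMeasure ((euclideanMetric V).inducedRiemannianMetric f
        contMDiff_pullbackBilin_holds hf) = ∫⁻ y in range f, g y ∂μHE[m] := by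
  have hme : MeasurableEmbedding f :=
    (hf.contMDiff.continuous.isClosedEmbedding hinj).measurableEmbedding
  rw [← map_riemannianMeasure_induced hf hinj, hme.lintegral_map]

/-- **Integration over the embedded submanifold** (Bochner): `∫_N g(f w) dμ_{f^*δ} = ∫_{f(N)} g d𝓗ᵐ`.
[cite: Federer1969, 3.2.3 and 3.2.46] -/
theorem integral_comp_riemannianMeasure_induced {f : N → V}
    (hf : (euclideanMetric V).IsSpacelikeImmersion (𝓡 m) f) (hinj : Injective f)
    {E : Type*} [NormedAddCommGroup E] [NormedSpace ℝ E] (g : V → E) :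
    ∫ w, g (f w) ∂riemannianMeasure ((euclideanMetric V).inducedRiemannianMetric f
        contMDiff_pullbackBilin_holds hf) = ∫ y in range f, g y ∂μHE[m] := by
  have hme : MeasurableEmbedding f :=
    (hf.contMDiff.continuous.isClosedEmbedding hinj).measurableEmbedding
  rw [← map_riemannianMeasure_induced hf hinj, hme.integral_map]

end InducedHausdorff

end Literature.Geometry.Riemannian

end
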